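import Summits.CriticalPhenomena.PercolationContinuityZ3.Theorems.PercNearOneGluingNoHeavyLowerTailApexForestGluingWalks
import HarnessLib

/-!
# Kozma–Nitzan Conjectures 1–2 on APEX-FOREST graphs — semantic bridge, part 1: the side decomposition across a forest edge
# (`NoHeavyLowerTail` cell, stmt-CriticalPhenomena-4575; new-inequality factory seat `prim-ineq-gen-7`, gen 3)

Support file (`--supports stmt-CriticalPhenomena-4575`).  Deterministic lemmas about open paths; no measure theory, no definitions, no named facts, no sorries.
Step L3 of the formalisation plan run/shared/lean/prim/prim-ineq-gen-7/LEAN-PLAN-APEXFOREST.md for the theorems "KN Conjecture 1 / Conjecture 2 whenever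
`G − b` is a forest" (paper proofs PROOF-CONJ1/CONJ2-APEXFOREST.md; algebraic and recursion levels already landed: `ApexForestAlgebra.step`,
`ApexForestRec.gluing_le`, `ApexForestPreFKG.step3`, `ApexForestPreFKGRec.preFKG_le`; walk lemmas `ApexForestWalks.*`).

* `ApexForestBridge.openConnIn_mono_config / openConnIn_mono_set / openConnIn_head` — bookkeeping for `openConnIn`;
* `ApexForestBridge.reachable_fromEdgeSet_of_mem_support` — an open walk using pairs of `E` stays inside the `fromEdgeSet E`-component;
* `ApexForestBridge.reachable_inter_of_openConnIn_compl` — a path avoiding the hub `c`, in a configuration whose pairs off `c` lie in `D`, uses only pairs of `ω ∩ D`;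
* `ApexForestBridge.openConnIn_compl_hub_iff` — **SIDE DECOMPOSITION**: if `e = s(o,v₁) ∈ D` is a bridge of `fromEdgeSet D` (the forest case) and every open pair lies
  in `D` or contains `c`, then `o` is joined to `u` off `c` iff it is joined to `u` inside its own side `S_o` (the `fromEdgeSet (D∖e)`-component of `o`), or `e` is
  open and `v₁` is joined to `u` inside its side `S₁`.  This is the set identity behind `C(o) = C'(o) ∪ [e open]·C₁(v₁)` in the paper proofs; with
  `ApexForestWalks.openConn_hub_iff` it turns `{o ↮ c}`, `{o ↮ A ∪ c}`, `{α ↮ c}` into side events determined by disjoint sets of pairs.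
[cite: Grimmett1999, §1.3 (open paths and clusters)]
-/

namespace Summit.CriticalPhenomena.PercolationContinuityZ3.Theorems

namespace ApexForestBridge

open Literature.Probability.Percolation ApexForestWalks

variable {V : Type*} [DecidableEq V]

omit [DecidableEq V] in
/-- Monotonicity of `openConnIn` in the configuration. [folklore] -/
theorem openConnIn_mono_config {ω ω' : BondConfig V} (h : ω ⊆ ω') {S : Set V} {u v : V}
    (huv : ω ∈ openConnIn S u v) : ω' ∈ openConnIn S u v := by
  have hp := DCT16.pathIn_of_mem_openConnIn huv
  refine DCT16.mem_openConnIn_of_pathIn ⟨hp.1, ?_⟩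
  have key : ∀ {w : V}, Relation.ReflTransGen (fun a b => (openGraph ω).Adj a b ∧ b ∈ S) u w →
      Relation.ReflTransGen (fun a b => (openGraph ω').Adj a b ∧ b ∈ S) u w := by
    intro w hw
    induction hw with
    | refl => exact Relation.ReflTransGen.refl
    | @tail a b _ hab ih =>
      have h1 := (openGraph_adj ω a b).1 hab.1
      exact ih.tail ⟨(openGraph_adj ω' a b).2 ⟨h h1.1, h1.2⟩, hab.2⟩
  exact key hp.2

omit [DecidableEq V] in
/-- Monotonicity of `openConnIn` in the vertex set. [folklore] -/
theorem openConnIn_mono_set {ω : BondConfig V} {S S' : Set V} (h : S ⊆ S') {u v : V}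
    (huv : ω ∈ openConnIn S u v) : ω ∈ openConnIn S' u v := by
  have hp := DCT16.pathIn_of_mem_openConnIn huv
  refine DCT16.mem_openConnIn_of_pathIn ⟨h hp.1, ?_⟩
  have key : ∀ {w : V}, Relation.ReflTransGen (fun a b => (openGraph ω).Adj a b ∧ b ∈ S) u w →
      Relation.ReflTransGen (fun a b => (openGraph ω).Adj a b ∧ b ∈ S') u w := by
    intro w hw
    induction hw with
    | refl => exact Relation.ReflTransGen.refl
    | @tail a b _ hab ih => exact ih.tail ⟨hab.1, h hab.2⟩
  exact key hp.2

omit [DecidableEq V] in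
/-- Prepending one open step inside `S` to a path in `S`. [folklore] -/
theorem openConnIn_head {ω : BondConfig V} {S : Set V} {a b v : V} (ha : a ∈ S)
    (hab : (openGraph ω).Adj a b) (hbv : ω ∈ openConnIn S b v) : ω ∈ openConnIn S a v := by
  have hp := DCT16.pathIn_of_mem_openConnIn hbv
  exact DCT16.mem_openConnIn_of_pathIn ⟨ha, Relation.ReflTransGen.head ⟨hab, hp.1⟩ hp.2⟩

/-- Every support vertex of an open walk using pairs of `E` is `fromEdgeSet E`-reachable from the start. [folklore] -/
theorem reachable_fromEdgeSet_of_mem_support {ω : BondConfig V} {E : Set (Sym2 V)} (hω : ω ⊆ E)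
    {u v : V} (p : (openGraph ω).Walk u v) {z : V} (hz : z ∈ p.support) :
    (SimpleGraph.fromEdgeSet E).Reachable u z := by
  have hle : openGraph ω ≤ SimpleGraph.fromEdgeSet E := by
    intro a b hab
    rw [openGraph_adj] at hab
    exact (SimpleGraph.fromEdgeSet_adj _).2 ⟨hω hab.1, hab.2⟩
  exact ((p.takeUntil z hz).reachable).mono hle

omit [DecidableEq V] in
/-- A path avoiding `c`, in a configuration whose pairs off `c` all lie in `D`, is an open walk using pairs of `ω ∩ D`; its endpoint is not `c`.
[folklore] -/
theorem reachable_inter_of_openConnIn_compl {ω : BondConfig V} {D : Set (Sym2 V)} {c o : V}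
    (hω : ∀ p ∈ ω, p ∈ D ∨ c ∈ p) (hoc : o ≠ c) {u : V} (h : ω ∈ openConnIn ({c}ᶜ : Set V) o u) :
    u ≠ c ∧ (openGraph (ω ∩ D)).Reachable o u := by
  have hpath := (DCT16.pathIn_of_mem_openConnIn h).2
  clear h
  induction hpath with
  | refl => exact ⟨hoc, SimpleGraph.Reachable.refl _⟩
  | @tail a b _ hstep ih =>
    obtain ⟨hadj, hbS⟩ := hstep
    have hbc : b ≠ c := fun hb => hbS (by rw [hb]; exact Set.mem_singleton c)
    obtain ⟨hac, hRa⟩ := ih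
    have h1 := (openGraph_adj ω a b).1 hadj
    have hD : s(a, b) ∈ D := by
      rcases hω _ h1.1 with hD | hc
      · exact hD
      · exfalso
        rcases Sym2.mem_iff.1 hc with h2 | h2
        · exact hac h2.symm
        · exact hbc h2.symm
    have hadj' : (openGraph (ω ∩ D)).Adj a b := (openGraph_adj _ a b).2 ⟨⟨h1.1, hD⟩, h1.2⟩
    exact ⟨hbc, hRa.trans hadj'.reachable⟩

/-- **Side decomposition across a bridge.**  `D` a set of pairs avoiding `c`; `e = s(o, v₁) ∈ D` a BRIDGE of `fromEdgeSet D` (`o`, `v₁` not joined in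
`fromEdgeSet (D ∖ {e})`); `ω` a configuration all of whose pairs lie in `D` or contain `c`.  With `S_o`, `S₁` the vertices reachable from `o`, `v₁` in
`fromEdgeSet (D ∖ {e})`:  `o` is joined to `u` OFF `c` iff it is joined to `u` inside `S_o`, or `e` is open and `v₁` is joined to `u` inside `S₁`. [folklore] -/
theorem openConnIn_compl_hub_iff {ω : BondConfig V} {D : Set (Sym2 V)} {c o v₁ : V}
    (hDc : ∀ p ∈ D, c ∉ p) (hov : o ≠ v₁) (he : s(o, v₁) ∈ D)
    (hbridge : ¬ (SimpleGraph.fromEdgeSet (D \ {s(o, v₁)})).Reachable o v₁)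
    (hω : ∀ p ∈ ω, p ∈ D ∨ c ∈ p) (u : V) :
    ω ∈ openConnIn ({c}ᶜ : Set V) o u ↔
      ω ∈ openConnIn {x | (SimpleGraph.fromEdgeSet (D \ {s(o, v₁)})).Reachable o x} o u ∨
        (s(o, v₁) ∈ ω ∧ ω ∈ openConnIn {x | (SimpleGraph.fromEdgeSet (D \ {s(o, v₁)})).Reachable v₁ x} v₁ u) := by
  set F' := SimpleGraph.fromEdgeSet (D \ {s(o, v₁)}) with hF'
  have hoc : o ≠ c := fun h => hDc _ he (h ▸ Sym2.mem_mk_left o v₁)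
  have hv₁c : v₁ ≠ c := fun h => hDc _ he (h ▸ Sym2.mem_mk_right o v₁)
  -- `c` is isolated in `F'`: everything `F'`-reachable from a vertex `≠ c` is `≠ c`
  have hcF' : ∀ x y, F'.Reachable x y → x ≠ c → y ≠ c := by
    intro x y hxy hxc hyc
    subst hyc
    rw [SimpleGraph.reachable_iff_reflTransGen] at hxy
    rcases Relation.ReflTransGen.cases_tail hxy with h | ⟨z, _, hzc⟩
    · exact hxc h.symm
    · have := (SimpleGraph.fromEdgeSet_adj _).1 hzc
      exact hDc _ this.1.1 (Sym2.mem_mk_right z y)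
  have hSo : {x | F'.Reachable o x} ⊆ ({c}ᶜ : Set V) := fun x hx hxc =>
    hcF' o x hx hoc (by simpa using hxc)
  have hS₁ : {x | F'.Reachable v₁ x} ⊆ ({c}ᶜ : Set V) := fun x hx hxc =>
    hcF' v₁ x hx hv₁c (by simpa using hxc)
  constructor
  · intro h
    obtain ⟨huc, hR⟩ := reachable_inter_of_openConnIn_compl hω hoc h
    set ω₀ : BondConfig V := ω ∩ (D \ {s(o, v₁)}) with hω₀
    have hω₀D : ω₀ ⊆ D \ {s(o, v₁)} := Set.inter_subset_right
    have hω₀ω : ω₀ ⊆ ω := Set.inter_subset_left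
    -- an `ω₀`-walk from `o` stays in `S_o`, from `v₁` stays in `S₁`; and `o`, `v₁` are not `ω₀`-joined
    have hstay : ∀ {x y : V} (p : (openGraph ω₀).Walk x y), ω ∈ openConnIn {z | F'.Reachable x z} x y := by
      intro x y p
      exact openConnIn_mono_config hω₀ω
        (pathIn_of_walk_support p (fun z hz => reachable_fromEdgeSet_of_mem_support hω₀D p hz))
    have hnot : ¬ (openGraph ω₀).Reachable o v₁ := by
      rintro ⟨p⟩
      exact hbridge (reachable_fromEdgeSet_of_mem_support hω₀D p p.end_mem_support)
    by_cases heω : s(o, v₁) ∈ ω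
    · -- `ω ∩ D = insert e ω₀`
      have hset : ω ∩ D = insert s(o, v₁) ω₀ := by
        ext p
        simp only [hω₀, Set.mem_inter_iff, Set.mem_insert_iff, Set.mem_sdiff, Set.mem_singleton_iff]
        constructor
        · rintro ⟨hp, hpD⟩
          by_cases hpe : p = s(o, v₁)
          · exact Or.inl hpe
          · exact Or.inr ⟨hp, hpD, hpe⟩
        · rintro (rfl | ⟨hp, hpD, _⟩)
          · exact ⟨heω, he⟩
          · exact ⟨hp, hpD⟩
      rw [hset] at hR
      rcases (reachable_insert_iff ω₀ hov o u).1 hR with h0 | ⟨_, h2⟩ | ⟨h1, _⟩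
      · left; obtain ⟨p⟩ := h0; exact hstay p
      · right; obtain ⟨p⟩ := h2; exact ⟨heω, hstay p⟩
      · exact absurd h1 hnot
    · -- `ω ∩ D = ω₀`
      have hset : ω ∩ D = ω₀ := by
        ext p
        simp only [hω₀, Set.mem_inter_iff, Set.mem_sdiff, Set.mem_singleton_iff]
        constructor
        · rintro ⟨hp, hpD⟩
          refine ⟨hp, hpD, ?_⟩
          rintro rfl
          exact heω hp
        · rintro ⟨hp, hpD, _⟩
          exact ⟨hp, hpD⟩
      rw [hset] at hR
      left; obtain ⟨p⟩ := hR; exact hstay p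
  · rintro (h | ⟨heω, h⟩)
    · exact openConnIn_mono_set hSo h
    · have h' : ω ∈ openConnIn ({c}ᶜ : Set V) v₁ u := openConnIn_mono_set hS₁ h
      have hadj : (openGraph ω).Adj o v₁ := (openGraph_adj ω o v₁).2 ⟨heω, hov⟩
      exact openConnIn_head (by simpa using hoc) hadj h'

end ApexForestBridge

end Summit.CriticalPhenomena.PercolationContinuityZ3.Theorems
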